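import Mathlib.Analysis.SpecialFunctions.Pow.Real

/-!
# Route `FordMaynardNoSieveConst0164`, crux `NegWitness0164` (stmt-Parity-19102), line `birth`,
# stub `stub_tweakNeg0164`: range certificates for polynomial pieces of the family inequalities

Helper file (def-free, elementary).  The one-parameter family inequalities of `stub_tweakNeg0164_of_family_bounds[_scaled]`
(`…FamilyTarget[Scaled]`) compare, on each α-piece `[β, β + H]`, an explicit polynomial `P(β + h)` of degree `≤ 6`
(majorant of the left-hand side) with an affine minorant `r₀ + r₁h` of the right-hand side (chord of the concave
logarithm).  The certificate used by the plan (evidence PLAN-II-families.md on stmt-Parity-19102) is the crude range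
bound from the Taylor coefficients at the left endpoint:

  `c₀ + Σ_{k ≥ 1} max(c_k, 0)·H^k ≤ 0  ⟹  ∀ h ∈ [0, H], Σ_k c_k h^k ≤ 0`

(`poly6_nonpos_of_coeffs`), together with the two-piece gluing `piecewise_glue` and the monomial bound
`coeff_mul_pow_le`.  These are the only non-numerical facts the generated per-family files need besides the moment
closed forms (K. Ford, J. Maynard, arXiv:2407.14368, §8).

References: [FordMaynard2024PrimeSieves] arXiv:2407.14368, §8 (proof of Theorem 2.7 (c)); folklore.
-/

noncomputable section

namespace Summit.Parity.GeneralizedHardyLittlewood.FordMaynardNoSieveConst0164NegWitness0164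

/-- A monomial on `[0, H]` is bounded by the positive part of its coefficient times `H^k`. [folklore] -/
theorem coeff_mul_pow_le (c H h : ℝ) (k : ℕ) (h0 : 0 ≤ h) (hH : h ≤ H) :
    c * h ^ k ≤ max c 0 * H ^ k := by
  have hk : h ^ k ≤ H ^ k := pow_le_pow_left₀ h0 hH k
  have hk0 : 0 ≤ h ^ k := pow_nonneg h0 k
  calc c * h ^ k ≤ max c 0 * h ^ k := mul_le_mul_of_nonneg_right (le_max_left c 0) hk0
    _ ≤ max c 0 * H ^ k := mul_le_mul_of_nonneg_left hk (le_max_right c 0)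

/-- **Range certificate for a degree-6 polynomial piece**: if `c₀ + Σ_{k=1}^{6} max(c_k,0) H^k ≤ 0` then
`c₀ + c₁h + ⋯ + c₆h⁶ ≤ 0` for all `h ∈ [0, H]`. [folklore] -/
theorem poly6_nonpos_of_coeffs (c0 c1 c2 c3 c4 c5 c6 H : ℝ)
    (hsum : c0 + max c1 0 * H + max c2 0 * H ^ 2 + max c3 0 * H ^ 3 + max c4 0 * H ^ 4 + max c5 0 * H ^ 5 +
      max c6 0 * H ^ 6 ≤ 0) (h : ℝ) (h0 : 0 ≤ h) (hH : h ≤ H) :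
    c0 + c1 * h + c2 * h ^ 2 + c3 * h ^ 3 + c4 * h ^ 4 + c5 * h ^ 5 + c6 * h ^ 6 ≤ 0 := by
  have e1 : c1 * h ≤ max c1 0 * H := by simpa using coeff_mul_pow_le c1 H h 1 h0 hH
  have e2 := coeff_mul_pow_le c2 H h 2 h0 hH
  have e3 := coeff_mul_pow_le c3 H h 3 h0 hH
  have e4 := coeff_mul_pow_le c4 H h 4 h0 hH
  have e5 := coeff_mul_pow_le c5 H h 5 h0 hH
  have e6 := coeff_mul_pow_le c6 H h 6 h0 hH
  linarith

/-- **Range certificate, degree 9** (for products with an extra factor). [folklore] -/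
theorem poly9_nonpos_of_coeffs (c0 c1 c2 c3 c4 c5 c6 c7 c8 c9 H : ℝ)
    (hsum : c0 + max c1 0 * H + max c2 0 * H ^ 2 + max c3 0 * H ^ 3 + max c4 0 * H ^ 4 + max c5 0 * H ^ 5 +
      max c6 0 * H ^ 6 + max c7 0 * H ^ 7 + max c8 0 * H ^ 8 + max c9 0 * H ^ 9 ≤ 0) (h : ℝ) (h0 : 0 ≤ h) (hH : h ≤ H) :
    c0 + c1 * h + c2 * h ^ 2 + c3 * h ^ 3 + c4 * h ^ 4 + c5 * h ^ 5 + c6 * h ^ 6 + c7 * h ^ 7 + c8 * h ^ 8 +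
      c9 * h ^ 9 ≤ 0 := by
  have e1 : c1 * h ≤ max c1 0 * H := by simpa using coeff_mul_pow_le c1 H h 1 h0 hH
  have e2 := coeff_mul_pow_le c2 H h 2 h0 hH
  have e3 := coeff_mul_pow_le c3 H h 3 h0 hH
  have e4 := coeff_mul_pow_le c4 H h 4 h0 hH
  have e5 := coeff_mul_pow_le c5 H h 5 h0 hH
  have e6 := coeff_mul_pow_le c6 H h 6 h0 hH
  have e7 := coeff_mul_pow_le c7 H h 7 h0 hH
  have e8 := coeff_mul_pow_le c8 H h 8 h0 hH
  have e9 := coeff_mul_pow_le c9 H h 9 h0 hH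
  linarith

/-- **Gluing two α-pieces**: a bound valid on `[a, b]` and on `[b, c]` is valid on `[a, c]`. [folklore] -/
theorem piecewise_glue {P : ℝ → Prop} {a b c : ℝ}
    (h1 : ∀ α, a ≤ α → α ≤ b → P α) (h2 : ∀ α, b ≤ α → α ≤ c → P α) :
    ∀ α, a ≤ α → α ≤ c → P α := by
  intro α ha hc
  rcases le_total α b with hb | hb
  · exact h1 α ha hb
  · exact h2 α hb hc

/-- **From a left-endpoint expansion to the piece**: if `Q(β + h) ≤ 0` for `h ∈ [0, H]` then `Q(α) ≤ 0` for
`α ∈ [β, β + H]`. [folklore] -/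
theorem piece_of_shift {Q : ℝ → Prop} {β H : ℝ} (h : ∀ h : ℝ, 0 ≤ h → h ≤ H → Q (β + h)) :
    ∀ α, β ≤ α → α ≤ β + H → Q α := by
  intro α h1 h2
  have := h (α - β) (by linarith) (by linarith)
  simpa using this

/-- **Chord below a concave right-hand side, with certified endpoint values**: if `R` lies above its chords on
`[α₁, α₂]` (e.g. `1 + log((α − ν)/ν)`), `ℓ₁ ≤ R α₁`, `ℓ₂ ≤ R α₂`, then the line through `(α₁, ℓ₁)`, `(α₂, ℓ₂)`
minorises `R` on `[α₁, α₂]`. [folklore] -/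
theorem line_le_of_chord_le {R : ℝ → ℝ} {α₁ α₂ ℓ₁ ℓ₂ : ℝ} (h12 : α₁ < α₂)
    (hchord : ∀ α, α₁ ≤ α → α ≤ α₂ →
      ((α₂ - α) * R α₁ + (α - α₁) * R α₂) / (α₂ - α₁) ≤ R α)
    (h₁ : ℓ₁ ≤ R α₁) (h₂ : ℓ₂ ≤ R α₂) :
    ∀ α, α₁ ≤ α → α ≤ α₂ → ℓ₁ + (ℓ₂ - ℓ₁) / (α₂ - α₁) * (α - α₁) ≤ R α := by
  intro α ha hb
  refine le_trans ?_ (hchord α ha hb)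
  have hd : 0 < α₂ - α₁ := by linarith
  rw [div_mul_eq_mul_div, ← sub_nonneg]
  have : ((α₂ - α) * R α₁ + (α - α₁) * R α₂) / (α₂ - α₁) - (ℓ₁ + (ℓ₂ - ℓ₁) * (α - α₁) / (α₂ - α₁)) =
      ((α₂ - α) * (R α₁ - ℓ₁) + (α - α₁) * (R α₂ - ℓ₂)) / (α₂ - α₁) := by
    field_simp
    ring
  rw [this]
  exact div_nonneg (by nlinarith [sub_nonneg.2 ha, sub_nonneg.2 hb, sub_nonneg.2 h₁, sub_nonneg.2 h₂]) hd.le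

end Summit.Parity.GeneralizedHardyLittlewood.FordMaynardNoSieveConst0164NegWitness0164

end
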